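import Literature.MathematicalPhysics.QuantumFieldTheory.ContinuumLimits
import HarnessLib

/-!
# Chatterjee's `SU(2)` Yang–Mills–Higgs measure before gauge fixing and the law of the unitary-gauge field (Lemma 5.4)

S. Chatterjee, *A scaling limit of `SU(2)` lattice Yang–Mills–Higgs theory*, Probab. Math. Phys.
**7** (2026) 339–381, arXiv:2401.10507 [Chatterjee2026YMHiggs], §1.4 (the `SU(2)` theory with a
Higgs field in the fundamental representation and the degenerate potential forcing `φ_x ∈ S³`;
unitary gauge fixing `θ_x φ_x = e₁`) and §5.2 **Lemma 5.4** (the probability density of the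
gauge-fixed field `V`); arXiv:2401.10507v4 numbering (v1: Lemma 5.3), as in the tree.

The tree's `ContinuumLimits.su2HiggsWeight` / `su2HiggsMeasure` (constructive-qft.S19) takes the
unitary-gauge density of Lemma 5.4, `exp (g_C⁻² ∑ₚ Re tr U_p + (α_C²/2) ∑ₑ Re tr U_e)`, as the
DEFINITION of the model (with the audited dictionary `g_C = √2 g`, `α_C = α`: Wave 0's
`wilsonWeight (fundamentalRep (Fin 2)) (2g²)⁻¹` times `exp ((α²/2) ∑ₑ Re tr U_e)`), recording in
prose that "the law of the gauge-fixed field `V` [is] the continuous image of that of `(U, φ)`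
(Lemma 5.4)". This file TYPES that sentence (cross-ladder literature-typing layer, D-0088;
statements only): the full measure `μ` of §1.4 on `Σ × Γ = SU(2)^E × (S³)^Λ`, the unitary gauge
map, and Lemma 5.4 as the named fact `su2UnitaryGauge_law` (D-0014; proved in the source) that the
push-forward of `μ` under gauge fixing is `su2HiggsMeasure`.

## Rendering of the Higgs field

`Γ = (S³)^Λ` with the product of uniform probability measures is parametrised by `SU(2)`-frames:
`φ_x = h_x e₁` with `h_x ∈ SU(2)`. The map `h ↦ h e₁ : SU(2) → S³ ⊆ ℂ²` is a bijection (§1.4: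
"there is a unique element `θ_x ∈ SU(2)` such that `θ_x φ_x = e₁`"; `θ_x = h_x⁻¹`) and pushes
normalised Haar measure to the uniform probability measure on `S³` (§3.2: "the pushforward of the
normalized Haar measure under `τ` is the uniform probability measure on `S³`", `τ(h) = (Re a, Im a,
Re b, Im b)` for `h = [[a, b], [−b̄, ā]]`, and `h e₁ = (a, −b̄)` is `τ(h)` followed by the isometry
`(x, y, w, z) ↦ (x, y, −w, z)` of `S³`; the tree's `QuantumLattice.SU2Haar` proves the Haar/`S³`
correspondence). In these coordinates `Re(φ_x^* U_e φ_y) = Re(e₁^* h_x^* U_e h_y e₁) =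
Re (h_x⁻¹ U_e h_y)₁₁` and the unitary-gauge field is `V_e = θ_x U_e θ_y^* = h_x⁻¹ U_e h_y`.
So the configuration space here is `GaugeConfig d L SU2 × (Site d L → SU2)` with product Haar,
an equivalent description of `Σ × Γ` with `∏ dU_e ∏ dφ_x`; this is the only deviation from print.
-/

noncomputable section

open scoped ENNReal
open MeasureTheory Finset
open Literature.MathematicalPhysics.QuantumLattice

namespace Literature.MathematicalPhysics.QuantumFieldTheory.Chatterjee2026YMHiggs

variable {d : ℕ}

/-- The full (not gauge-fixed) `SU(2)` Yang–Mills–Higgs weight of §1.4 on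
`Σ × Γ = SU(2)^E × (S³)^Λ`, Higgs field in the fundamental representation with the degenerate
potential (`W = 0` on `S³ ⊆ ℂ²`, `∞` outside), in Higgs-frame coordinates `φ_x = h_x e₁`
(module docstring): `exp (g_C⁻² ∑ₚ Re tr U_p + α_C² ∑_{e=(x,y)} Re(φ_x^* U_e φ_y)) ∏ₑ dU_e ∏ₓ dφ_x`
with `Re(φ_x^* U_e φ_y) = Re (h_x⁻¹ U_e h_y)₁₁`, `y = x + eᵢ` for `e = (x, i)` (`Site.shift`),
up to the constant `e^{−2g_C⁻²|P|}`, in the tree's normalisation `g_C = √2 g`, `α_C = α` of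
`su2HiggsWeight` (Wave 0's `wilsonWeight (fundamentalRep (Fin 2)) (2g²)⁻¹`, density
`exp (−(2g²)⁻¹ ∑ₚ Re tr (1 − U_p))`). Junk: `β = 0` at `g = 0`. [cite: Chatterjee2026YMHiggs, §1.4 (1.2) and the display defining μ] -/
def su2FullHiggsWeight (L : ℕ) [NeZero L] (g α : ℝ) :
    Measure (GaugeConfig d L SU2 × (Site d L → SU2)) :=
  ((wilsonWeight (d := d) (L := L) (fundamentalRep (Fin 2)) (2 * g ^ 2)⁻¹).prod
      (Measure.pi fun _ : Site d L => haarProbability SU2)).withDensity fun Uh =>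
    ENNReal.ofReal (Real.exp (α ^ 2 * ∑ e : Edge d L,
      (fundamentalRep (Fin 2) ((Uh.2 e.1)⁻¹ * Uh.1 e * Uh.2 (e.1.shift e.2)) 0 0).re))

/-- The full `SU(2)` Yang–Mills–Higgs probability measure `μ` of §1.4
(`su2FullHiggsWeight` normalised by its total mass; junk zero measure if that mass is `0` or `∞`,
which does not happen for `L ≥ 1`). [cite: Chatterjee2026YMHiggs, §1.4 (the measure μ)] -/
def su2FullHiggsMeasure (L : ℕ) [NeZero L] (g α : ℝ) :
    Measure (GaugeConfig d L SU2 × (Site d L → SU2)) :=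
  (su2FullHiggsWeight (d := d) L g α Set.univ)⁻¹ • su2FullHiggsWeight L g α

/-- **Unitary gauge fixing** for the `SU(2)` theory (§1.4): with `θ_x ∈ SU(2)` the unique element
with `θ_x φ_x = e₁` — in Higgs-frame coordinates `θ_x = h_x⁻¹` — the gauge-fixed field is
`V_e = θ_x U_e θ_y^* = h_x⁻¹ U_e h_y` for `e = (x, y)`, `y = x + eᵢ` (and the transformed Higgs
field is `ψ ≡ e₁`). [cite: Chatterjee2026YMHiggs, §1.4 (unitary gauge fixing)] -/
def su2UnitaryGauge {L : ℕ} (Uh : GaugeConfig d L SU2 × (Site d L → SU2)) :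
    GaugeConfig d L SU2 :=
  fun e => (Uh.2 e.1)⁻¹ * Uh.1 e * Uh.2 (e.1.shift e.2)

/-- **Lemma 5.4** (the law of the unitary-gauge field of the `SU(2)` theory; named fact, D-0014 —
proved in the source: for fixed `φ` the map `U ↦ g(U, φ)` preserves product Haar,
`S(U, φ) = H(g(U, φ))` with `Re(e₁^* A e₁) = ½ Re tr A` on `SU(2)`, then integrate out `φ`).
*Printed:* "The probability density of `V` with respect to the product of Haar probability
measures on `SU(2)^E` is proportional to `exp (g⁻² ∑ₚ Re(tr(U_p)) + (α²/2) ∑ₑ Re(tr(U_e)))` at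
`U ∈ SU(2)^E`" (the paper's `g, α`, i.e. `g_C, α_C` of the tree's dictionary), `V` the
unitary-gauge field of §1.4 on the finite torus `Λ` under `μ`. *Rendered:* for `g > 0`, `α > 0`
(standing hypotheses of §1.1) and every torus side `L ≥ 1`, the push-forward of
`su2FullHiggsMeasure L g α` under `su2UnitaryGauge` is the tree's `su2HiggsMeasure L g α` of
`ContinuumLimits` — whose density `exp ((2g²)⁻¹ ∑ₚ Re tr U_p + (α²/2) ∑ₑ Re tr U_e)` is the
printed one under `g_C = √2 g`, `α_C = α` (audit in `ContinuumLimits`, module docstring "S19").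
Deviation: Higgs field in `SU(2)`-frame coordinates `φ_x = h_x e₁` with Haar measure (module
docstring; §3.2 for Haar ↔ uniform on `S³`). [cite: Chatterjee2026YMHiggs, Lemma 5.4 (§5.2; arXiv v4 numbering, v1: Lemma 5.3); proof ibid.] -/
def su2UnitaryGauge_law : Prop :=
  ∀ (d L : ℕ) [NeZero L] (g α : ℝ), 0 < g → 0 < α →
    (su2FullHiggsMeasure (d := d) L g α).map su2UnitaryGauge = su2HiggsMeasure (d := d) L g α

end Literature.MathematicalPhysics.QuantumFieldTheory.Chatterjee2026YMHiggs
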